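import Literature.NumberTheory.EllipticCurves.GaloisConjugateReductionTypeProofs
import Literature.NumberTheory.EllipticCurves.SelmerUnramified
import Literature.NumberTheory.EllipticCurves.DivisionPolynomialTorsion
import Literature.NumberTheory.DiophantineGeometry.LocalReductionFiniteBadPlacesProofs
import HarnessLib

/-!
# The canonical `σ`-stable bad set of a base-changed `ℚ`-curve: places above `p` and places of bad reduction
# (proofs file)

Topic `NumberTheory/EllipticCurves` (cell `pub/bsd-print-x9`; the `(S, hpS, hbad, hSσ)` slots of the curve's Eisenstein
`DVRSetting`, STUB-A-RECIPE §3 «OPEN (small, unowned): a canonical σ-stable S»).  THEOREMS ONLY; no definition, no named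
fact, no instance, no notation, no `sorry`.

For an elliptic curve `E = W/ℚ`, a number field `K`, a prime `p` and `σ ∈ Aut(K/ℚ)`:
* **`WeierstrassCurve.baseChange_map_algEquiv`** — `(E_K)^σ = E_K` (the equation has rational coefficients);
* **`WeierstrassCurve.hasGoodReductionAt_baseChange_algEquiv_smul_iff`** — `E_K` has good reduction at `σ • v` iff at `v`
  (the tree's `hasGoodReductionAt_algEquiv_smul_iff_of_smul_eq_map`, Silverman VII.5.1 transported along `K_v ≃ K_{σ v}`,
  applied with the identity change of variables);
* **`WeierstrassCurve.exists_sigmaStable_badFinset`** — the finite set `S = {v ∣ p} ∪ {v : E_K has bad reduction at v}`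
  (`finite_setOf_intCast_mem_asIdeal`, `finite_badPlaces_holds`) with: every place above `p` is in `S`; `E_K` has good
  reduction at every `v ∉ S` prime to `p`; `σ • v ∈ S → v ∈ S`; and the membership characterisation — verbatim the
  hypotheses `hpS`, `hbad`, `hSσ` of `WeierstrassCurve.eisensteinDVRSetting`, `eisensteinDVRSetting_h5b_of`,
  `eisensteinDVRSetting_h4_of_ofLifts`.

BSD is not proved by any of this.

References: [SilvermanAEC2009] VII.5 Prop. 5.1, VII.1 Prop. 1.3(b), VIII.1 (the finite set `S`);
[CasselsFrohlichANT1967] Ch. VII §1.1 (action of `Aut(K)` on places).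
-/

set_option autoImplicit false

noncomputable section

open NumberField IsDedekindDomain

namespace WeierstrassCurve

open Literature.NumberTheory.Automorphic

variable {K : Type*} [Field K] [NumberField K] (W : WeierstrassCurve ℚ)

/-- **`(E_K)^σ = E_K`**: the base change to `K` of a `ℚ`-curve is fixed by every `σ ∈ Aut(K/ℚ)` acting on the coefficients.
[cite: SilvermanAEC2009, VII.1 (Weierstrass equations and their transforms)] -/
theorem baseChange_map_algEquiv (σ : K ≃ₐ[ℚ] K) : (W.baseChange K).map (σ : K →+* K) = W.baseChange K := by
  rw [baseChange, map_map]
  congr 1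
  exact RingHom.ext fun q ↦ by simp

/-- **Good reduction of `E_K` at `σ • v` iff at `v`** for a `ℚ`-curve `E = W` and `σ ∈ Aut(K/ℚ)`: `σ` induces an isomorphism
of valued fields `K_v ≃ K_{σ v}` carrying a minimal model to a minimal model, and `E_K^σ = E_K`.
[cite: SilvermanAEC2009, VII.5 Prop. 5.1 and VII.1 Prop. 1.3(b)] [cite: CasselsFrohlichANT1967, Ch. VII §1.1] -/
theorem hasGoodReductionAt_baseChange_algEquiv_smul_iff [W.IsElliptic] (σ : K ≃ₐ[ℚ] K)
    (v : HeightOneSpectrum (𝓞 K)) :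
    (W.baseChange K).HasGoodReductionAt (σ • v) ↔ (W.baseChange K).HasGoodReductionAt v :=
  hasGoodReductionAt_algEquiv_smul_iff_of_smul_eq_map σ v (W.baseChange K) (C := 1)
    (by rw [one_smul, W.baseChange_map_algEquiv σ])

/-- **The canonical `σ`-stable bad set.**  For `E = W/ℚ` elliptic, `K` a number field, `p` a prime and `σ ∈ Aut(K/ℚ)`
there is a finite set `S` of finite places of `K` — the places above `p` together with the places of bad reduction of
`E_K` — such that: `v ∈ S ↔ p ∈ v ∨ E_K` has bad reduction at `v`; every place above `p` lies in `S`; `E_K` has good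
reduction at every `v ∉ S` not above `p`; and `σ • v ∈ S → v ∈ S`.
[cite: SilvermanAEC2009, VIII.1 (the finite set S ⊇ {v ∣ m} ∪ {bad places}) and VII.5 Prop. 5.1] -/
theorem exists_sigmaStable_badFinset [W.IsElliptic] (p : ℕ) [hp : Fact p.Prime] (σ : K ≃ₐ[ℚ] K) :
    ∃ S : Finset (HeightOneSpectrum (𝓞 K)),
      (∀ v, v ∈ S ↔ ((p : ℕ) : 𝓞 K) ∈ v.asIdeal ∨ ¬ (W.baseChange K).HasGoodReductionAt v) ∧
      (∀ v : HeightOneSpectrum (𝓞 K), ((p : ℕ) : 𝓞 K) ∈ v.asIdeal → v ∈ S) ∧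
      (∀ v : HeightOneSpectrum (𝓞 K), v ∉ S → ((p : ℕ) : 𝓞 K) ∉ v.asIdeal →
        (W.baseChange K).HasGoodReductionAt v) ∧
      (∀ v : HeightOneSpectrum (𝓞 K), σ • v ∈ S → v ∈ S) := by
  classical
  have hfin : ({v : HeightOneSpectrum (𝓞 K) | ((p : ℤ) : 𝓞 K) ∈ v.asIdeal} ∪
      (W.baseChange K).badPlaces (𝓞 K)).Finite :=
    (finite_setOf_intCast_mem_asIdeal (by exact_mod_cast hp.out.ne_zero)).union
      ((W.baseChange K).finite_badPlaces_holds (𝓞 K))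
  refine ⟨hfin.toFinset, fun v ↦ ?_, fun v hv ↦ ?_, fun v hvS hv ↦ ?_, fun v hv ↦ ?_⟩
  · rw [Set.Finite.mem_toFinset, Set.mem_union, Set.mem_setOf_eq, mem_badPlaces_iff, Int.cast_natCast]
  · rw [Set.Finite.mem_toFinset, Set.mem_union, Set.mem_setOf_eq, Int.cast_natCast]
    exact Or.inl hv
  · by_contra hgood
    exact hvS ((Set.Finite.mem_toFinset _).mpr (Or.inr ((mem_badPlaces_iff _ _).mpr hgood)))
  · rw [Set.Finite.mem_toFinset, Set.mem_union, Set.mem_setOf_eq, mem_badPlaces_iff] at hv ⊢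
    have hσp : σ • (((p : ℤ) : 𝓞 K)) = ((p : ℤ) : 𝓞 K) := map_intCast (MulSemiringAction.toRingHom _ (𝓞 K) σ) p
    rcases hv with hv | hv
    · left
      rwa [← hσp, HeightOneSpectrum.smul_mem_smul_asIdeal_iff] at hv
    · right
      rwa [W.hasGoodReductionAt_baseChange_algEquiv_smul_iff σ v] at hv

end WeierstrassCurve

end
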